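import Literature.Geometry.Riemannian.GurskyViaclovskyClosednessEKBoundsAux
import HarnessLib

/-!
# Gursky–Viaclovsky closedness: quantitative bounds for the Evans–Krylov form of the chart
# equation, II (the uniform hybrid admissibility margin)

Support file (everything PROVED; no definition, no named fact) for the named fact
`Literature.Geometry.Riemannian.gurskyViaclovsky_pathClosed_weighted_four`
(Gursky–Viaclovsky, J. Differential Geom. 63 (2003), Prop. 6: the interior `C^{2,α}` estimate
behind the closedness of the weighted `σ₂` path is Evans–Krylov's, Gilbarg–Trudinger Thm. 17.14).
With `𝒜 = 𝒜^t(y, p, r)` (`gvForm`), `τ = tr_G 𝒜` (`mtrAt`) and `Σ = ½(τ² − |𝒜|²_G)`, the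
hypothesis (ii)' of Thm. 17.14 is used at the HYBRID jets `(y, Du(y), D²u(x))`, which must stay
in the admissible region; together with `GurskyViaclovskyClosednessEKBoundsAux.lean`
(uniform ellipticity `ekOperator_symbol_bounds_of_solution`, uniform `C²` bounds
`exists_ekOperator_deriv_bounds`) this file completes the constants `(λ, Λ, μ, δ₀)` of the
abstract Evans–Krylov theorem for the jet function `ekOperator`
(`GurskyViaclovskyClosednessEKOperatorDef.lean`):

* `exists_hybrid_margin_uniform_of_isMetricOn` — for metric components `G` on an open set `V`
  of a finite-dimensional space `E`: a margin radius `δ₀ > 0`, uniform in the parameter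
  `|t| ≤ T` and along all `C²` functions `F` with `‖DF‖ ≤ P₀`, `‖D²F‖ ≤ R₀` on a closed ball
  `B̄(y₀, ρ) ⊆ V`, such that `Σ, τ ≥ c` at the jets `(x, DF(x), D²F(x))` give `Σ, τ ≥ c/2` at
  the hybrid jets `(y, DF(y), D²F(x))` whenever `|x − y| ≤ δ₀`. Proof: `Σ` and `τ` are jointly
  `C^∞` in `(t, y, p, r)` on `{y ∈ V}` (`contDiffOn_gvForm_param`, `contDiffOn_mtrAt_comp`,
  `contDiffOn_normSqAt_comp`), hence Lipschitz on the compact convex set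
  `[−T, T] × B̄(y₀, ρ) × B̄(0, P₀) × B̄(0, R₀)` (`exists_lipschitz_of_contDiffOn`), so on every
  slice `{t} × …` with the same constant `L`, and `hybrid_ge_half` applies with
  `δ₀ = min(ρ, c/(2(L+1)(1+|R₀|)))`;
* `exists_hybrid_margin_uniform` — the same on an open subset `U ⊆ ℝ⁴` carrying a Riemannian
  metric `g` with components `G` (`OpensChart.isMetricOn_repr`).

## References

* D. Gilbarg, N. S. Trudinger, *Elliptic Partial Differential Equations of Second Order* (2001),
  §17.4, proof of Thm. 17.14 (hybrid jets `(y, u(y), Du(y), D²u(x))`). [GilbargTrudinger2001]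
* M. J. Gursky, J. A. Viaclovsky, J. Differential Geom. 63 (2003) 131–154, Prop. 6, §5.
  [GurskyViaclovsky2003]
-/

noncomputable section

set_option maxSynthPendingDepth 3

open scoped Manifold ContDiff Topology
open Set Filter Metric Function Module

namespace Literature.Geometry.Riemannian.GurskyViaclovskyPath

open Literature.Geometry.Lorentzian (PseudoRiemannianMetric)
open Literature.Geometry.Lorentzian.PseudoRiemannianMetric
open Literature.Geometry.Lorentzian
open Literature.Geometry.Lorentzian.MetricCoord
open Literature.Geometry.Riemannian.GurskyViaclovsky
open Literature.Analysis.Calculus Literature.Analysis.PDE.EvansKrylov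

/-! ### The uniform hybrid admissibility margin over metric components on an open set -/

section General

variable {E : Type*} [NormedAddCommGroup E] [NormedSpace ℝ E] [FiniteDimensional ℝ E]
  [CompleteSpace E] {G : E → E →L[ℝ] E →L[ℝ] ℝ} {V : Set E}

/-- **Uniform admissibility margin of the hybrid jets** for metric components `G` on an open set
`V`: for a closed ball `B̄(y₀, ρ) ⊆ V`, bounds `T, P₀, R₀` and a margin `c > 0` there is
`δ₀ > 0` such that for every `|t| ≤ T` and every `F` with `DF` differentiable, `‖DF‖ ≤ P₀`,
`‖D²F‖ ≤ R₀` on the ball, `Σ^t ≥ c` and `tr_G 𝒜^t ≥ c` at the jets of `F` imply `Σ^t ≥ c/2` and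
`tr_G 𝒜^t ≥ c/2` at the hybrid jets `(y, DF(y), D²F(x))`, `|x − y| ≤ δ₀` (`Σ^t`, `tr_G 𝒜^t`
are jointly `C^∞` in `(t, y, p, r)`, hence Lipschitz on `[−T,T] × B̄(y₀,ρ) × B̄(0,P₀) × B̄(0,R₀)`
by `exists_lipschitz_of_contDiffOn`, uniformly on the slices `{t} × …`; `hybrid_ge_half`).
[cite: GilbargTrudinger2001, §17.4, proof of Thm. 17.14] -/
theorem exists_hybrid_margin_uniform_of_isMetricOn (hmet : IsMetricOn G V) {y₀ : E} {ρ : ℝ}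
    (hρ : 0 < ρ) (hBV : closedBall y₀ ρ ⊆ V) (T P₀ R₀ : ℝ) {c : ℝ} (hc : 0 < c) :
    ∃ δ₀ : ℝ, 0 < δ₀ ∧ ∀ t : ℝ, |t| ≤ T → ∀ F : E → ℝ,
      (∀ z ∈ closedBall y₀ ρ, DifferentiableAt ℝ (fderiv ℝ F) z) →
      (∀ z ∈ closedBall y₀ ρ, ‖fderiv ℝ F z‖ ≤ P₀) →
      (∀ z ∈ closedBall y₀ ρ, ‖fderiv ℝ (fderiv ℝ F) z‖ ≤ R₀) →
      (∀ x ∈ closedBall y₀ ρ,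
        c ≤ 1 / 2 * (mtrAt G x (gvForm G t x (fderiv ℝ F x) (fderiv ℝ (fderiv ℝ F) x)) ^ 2 -
            normSqAt G x (gvForm G t x (fderiv ℝ F x) (fderiv ℝ (fderiv ℝ F) x))) ∧
        c ≤ mtrAt G x (gvForm G t x (fderiv ℝ F x) (fderiv ℝ (fderiv ℝ F) x))) →
      ∀ x ∈ closedBall y₀ ρ, ∀ y ∈ closedBall y₀ ρ, dist x y ≤ δ₀ →
        c / 2 ≤ 1 / 2 * (mtrAt G y (gvForm G t y (fderiv ℝ F y) (fderiv ℝ (fderiv ℝ F) x)) ^ 2 -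
            normSqAt G y (gvForm G t y (fderiv ℝ F y) (fderiv ℝ (fderiv ℝ F) x))) ∧
        c / 2 ≤ mtrAt G y (gvForm G t y (fderiv ℝ F y) (fderiv ℝ (fderiv ℝ F) x)) := by
  -- the parameter-jet space `ℝ × E × E* × Bil(E)` and the two smooth functions `τ`, `Σ`
  set V' : Set (ℝ × E × (E →L[ℝ] ℝ) × (E →L[ℝ] E →L[ℝ] ℝ)) := {x | x.2.1 ∈ V}
  have hV'o : IsOpen V' := hmet.isOpen.preimage (continuous_fst.comp continuous_snd)
  have hπ : ContDiffOn ℝ ∞ (fun x : ℝ × E × (E →L[ℝ] ℝ) × (E →L[ℝ] E →L[ℝ] ℝ) ↦ x.2.1) V' :=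
    contDiff_snd.fst.contDiffOn
  have hD : MapsTo (fun x : ℝ × E × (E →L[ℝ] ℝ) × (E →L[ℝ] E →L[ℝ] ℝ) ↦ x.2.1) V' V :=
    fun _ hx ↦ hx
  have hA := contDiffOn_gvForm_param hmet (V := V)
  set tr : ℝ × E × (E →L[ℝ] ℝ) × (E →L[ℝ] E →L[ℝ] ℝ) → ℝ :=
    fun x ↦ mtrAt G x.2.1 (gvForm G x.1 x.2.1 x.2.2.1 x.2.2.2)
  set sig : ℝ × E × (E →L[ℝ] ℝ) × (E →L[ℝ] E →L[ℝ] ℝ) → ℝ :=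
    fun x ↦ 1 / 2 * (mtrAt G x.2.1 (gvForm G x.1 x.2.1 x.2.2.1 x.2.2.2) ^ 2 -
      normSqAt G x.2.1 (gvForm G x.1 x.2.1 x.2.2.1 x.2.2.2))
  have htr : ContDiffOn ℝ ∞ tr V' := contDiffOn_mtrAt_comp hmet hπ hD hA
  have hsig : ContDiffOn ℝ ∞ sig V' :=
    contDiffOn_const.mul ((htr.pow 2).sub (contDiffOn_normSqAt_comp hmet hπ hD hA))
  have h1 : (1 : ℕ∞ω) ≤ ((⊤ : ℕ∞) : ℕ∞ω) := WithTop.coe_le_coe.mpr le_top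
  -- the compact convex parameter-jet set and the Lipschitz constants
  set Kt : Set (ℝ × E × (E →L[ℝ] ℝ) × (E →L[ℝ] E →L[ℝ] ℝ)) :=
    Icc (-T) T ×ˢ (closedBall y₀ ρ ×ˢ (closedBall (0 : E →L[ℝ] ℝ) P₀ ×ˢ
      closedBall (0 : E →L[ℝ] E →L[ℝ] ℝ) R₀))
  obtain ⟨hJc, hJconv⟩ := jetSet_compact_convex y₀ ρ P₀ R₀ (E := E)
  have hKt : IsCompact Kt := isCompact_Icc.prod hJc
  have hKtc : Convex ℝ Kt := (convex_Icc _ _).prod hJconv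
  have hKtV : Kt ⊆ V' := fun x hx ↦ hBV hx.2.1
  obtain ⟨L₁, hL₁0, hL₁⟩ := exists_lipschitz_of_contDiffOn hV'o (hsig.of_le h1) hKt hKtc hKtV
  obtain ⟨L₂, _, hL₂⟩ := exists_lipschitz_of_contDiffOn hV'o (htr.of_le h1) hKt hKtc hKtV
  set L := max L₁ L₂
  have hL0 : 0 ≤ L := hL₁0.trans (le_max_left _ _)
  set D := (L + 1) * (1 + |R₀|) with hD_def
  have hD0 : 0 < D := by rw [hD_def]; positivity
  refine ⟨min ρ (c / (2 * D)), lt_min hρ (by positivity), ?_⟩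
  intro t ht F hFd hP hR hadm x hx y hy hxy
  have hR0 : 0 ≤ R₀ := (norm_nonneg _).trans (hR x hx)
  have htI : t ∈ Icc (-T) T := abs_le.1 ht
  -- `L (1 + R₀) ‖y − x‖ ≤ c/2`
  have hδ : L * ((1 + R₀) * ‖y - x‖) ≤ c / 2 := by
    have hyx : ‖y - x‖ ≤ c / (2 * D) := by
      rw [← dist_eq_norm, dist_comm]
      exact hxy.trans (min_le_right _ _)
    have hLD : L * (1 + R₀) ≤ D := by
      rw [hD_def]
      exact mul_le_mul (by linarith) (by linarith [le_abs_self R₀]) (by linarith) (by linarith)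
    calc L * ((1 + R₀) * ‖y - x‖) = L * (1 + R₀) * ‖y - x‖ := by ring
      _ ≤ D * (c / (2 * D)) := mul_le_mul hLD hyx (norm_nonneg _) hD0.le
      _ = c / 2 := by field_simp
  -- Lipschitz bounds on the slice `{t} × jet set`
  have hslice : ∀ {φ : ℝ × E × (E →L[ℝ] ℝ) × (E →L[ℝ] E →L[ℝ] ℝ) → ℝ} {L' : ℝ}, L' ≤ L →
      (∀ j ∈ Kt, ∀ j' ∈ Kt, |φ j' - φ j| ≤ L' * ‖j' - j‖) →
      ∀ j ∈ closedBall y₀ ρ ×ˢ (closedBall (0 : E →L[ℝ] ℝ) P₀ ×ˢ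
          closedBall (0 : E →L[ℝ] E →L[ℝ] ℝ) R₀),
      ∀ j' ∈ closedBall y₀ ρ ×ˢ (closedBall (0 : E →L[ℝ] ℝ) P₀ ×ˢ
          closedBall (0 : E →L[ℝ] E →L[ℝ] ℝ) R₀),
        |φ (t, j') - φ (t, j)| ≤ L * ‖j' - j‖ := by
    intro φ L' hL' hφ j hj j' hj'
    have h := hφ (t, j) ⟨htI, hj⟩ (t, j') ⟨htI, hj'⟩
    have hn : ‖((t, j') : ℝ × E × (E →L[ℝ] ℝ) × (E →L[ℝ] E →L[ℝ] ℝ)) - (t, j)‖ = ‖j' - j‖ := by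
      rw [Prod.mk_sub_mk, sub_self, Prod.norm_mk, norm_zero, max_eq_right (norm_nonneg _)]
    rw [hn] at h
    exact h.trans (mul_le_mul_of_nonneg_right hL' (norm_nonneg _))
  constructor
  · exact hybrid_ge_half (Φ := fun j ↦ sig (t, j)) hL0 (hslice (le_max_left _ _) hL₁) hFd hP hR
      hx hy (hadm x hx).1 hδ
  · exact hybrid_ge_half (Φ := fun j ↦ tr (t, j)) hL0 (hslice (le_max_right _ _) hL₂) hFd hP hR
      hx hy (hadm x hx).2 hδ

end General

/-! ### The uniform hybrid admissibility margin on an open subset of `ℝ⁴` -/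

section OpensChart

variable {U : TopologicalSpace.Opens (EuclideanSpace ℝ (Fin 4))}
  (g : PseudoRiemannianMetric 𝓘(ℝ, EuclideanSpace ℝ (Fin 4)) ∞ (EuclideanSpace ℝ (Fin 4))
    (TangentSpace 𝓘(ℝ, EuclideanSpace ℝ (Fin 4)) : U → Type _))
  [g.HasLeviCivita]
  {G : EuclideanSpace ℝ (Fin 4) →
    EuclideanSpace ℝ (Fin 4) →L[ℝ] EuclideanSpace ℝ (Fin 4) →L[ℝ] ℝ}
  (hG : ∀ y : U, g.val y = G y)

omit [g.HasLeviCivita] in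
include hG in
/-- **Uniform admissibility margin of the hybrid jets** (the `δ₀` of Gilbarg–Trudinger's use of
(ii)' at the hybrid points `(y, u(y), Du(y), D²u(x))`, uniformly in the parameter `|t| ≤ T` and
along all `C²` functions with `‖DF‖ ≤ P₀`, `‖D²F‖ ≤ R₀` on a closed chart ball): if `Σ^t ≥ c`
and `τ^t = tr_G 𝒜^t ≥ c` at the jets of `F`, then `Σ^t, τ^t ≥ c/2` at the hybrid jets
`(y, DF(y), D²F(x))` whenever `|x − y| ≤ δ₀` — `Σ^t`, `τ^t` are `C^∞` in `(t, y, p, r)` jointly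
(`contDiffOn_chartOperator_param` with `W = 0`, `contDiffOn_gvForm_param` +
`contDiffOn_mtrAt_comp`), hence Lipschitz on the compact convex set
`[−T,T] × B̄(y₀,ρ) × B̄(0,P₀) × B̄(0,R₀)` (`exists_lipschitz_of_contDiffOn`), and `hybrid_ge_half`
applies for each `t`.
[cite: GilbargTrudinger2001, §17.4, proof of Thm. 17.14; GurskyViaclovsky2003, Prop. 6] -/
theorem exists_hybrid_margin_uniform {y₀ : EuclideanSpace ℝ (Fin 4)} {ρ : ℝ} (hρ : 0 < ρ)
    (hBU : closedBall y₀ ρ ⊆ (U : Set (EuclideanSpace ℝ (Fin 4)))) (T P₀ R₀ : ℝ) {c : ℝ}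
    (hc : 0 < c) :
    ∃ δ₀ : ℝ, 0 < δ₀ ∧ ∀ t : ℝ, |t| ≤ T → ∀ F : EuclideanSpace ℝ (Fin 4) → ℝ,
      (∀ z ∈ closedBall y₀ ρ, DifferentiableAt ℝ (fderiv ℝ F) z) →
      (∀ z ∈ closedBall y₀ ρ, ‖fderiv ℝ F z‖ ≤ P₀) →
      (∀ z ∈ closedBall y₀ ρ, ‖fderiv ℝ (fderiv ℝ F) z‖ ≤ R₀) →
      (∀ x ∈ closedBall y₀ ρ,
        c ≤ 1 / 2 * (mtrAt G x (gvForm G t x (fderiv ℝ F x) (fderiv ℝ (fderiv ℝ F) x)) ^ 2 -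
            normSqAt G x (gvForm G t x (fderiv ℝ F x) (fderiv ℝ (fderiv ℝ F) x))) ∧
        c ≤ mtrAt G x (gvForm G t x (fderiv ℝ F x) (fderiv ℝ (fderiv ℝ F) x))) →
      ∀ x ∈ closedBall y₀ ρ, ∀ y ∈ closedBall y₀ ρ, dist x y ≤ δ₀ →
        c / 2 ≤ 1 / 2 * (mtrAt G y (gvForm G t y (fderiv ℝ F y) (fderiv ℝ (fderiv ℝ F) x)) ^ 2 -
            normSqAt G y (gvForm G t y (fderiv ℝ F y) (fderiv ℝ (fderiv ℝ F) x))) ∧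
        c / 2 ≤ mtrAt G y (gvForm G t y (fderiv ℝ F y) (fderiv ℝ (fderiv ℝ F) x)) :=
  exists_hybrid_margin_uniform_of_isMetricOn (OpensChart.isMetricOn_repr hG) hρ hBU T P₀ R₀ hc

end OpensChart

end Literature.Geometry.Riemannian.GurskyViaclovskyPath

end
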